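import Literature.MathematicalPhysics.QuantumFieldTheory.Balaban1983to89.B8Prop6DentedCubeMemberScalarGammaOfNamedFactsRec
import Literature.MathematicalPhysics.QuantumFieldTheory.Balaban1983to89.B8Ineq159FlatCovDentedCubeMemberRec

/-!
# `Balaban1983to89.B8Prop6DentedCubeMemberScalarGammaHoldsRec` — [Balaban1985RegularSpaces] PROPOSITION 6 (p. 99) AS `Node00.GaugedBoundB8DZ` AT EVERY DENTED CENTRED CUBE MEMBER OF
# [Balaban1985Variational] (148)–(150), FOR THE RECORD's AVERAGING ([Balaban1987RG1] (0.3)–(0.4)), ODD `L = 2s+1 ≥ 5`, `d ≥ 2` — UNCONDITIONAL: the «N05-REC» R6 crown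
# `gaugedBoundB8DZ_dentedMember_of_cov159` with BOTH named inputs ([4] Thm 3.3 ∕ [6] (1.59), (1.62) at `U₀ = 1` for `Q_j(1) = linCovIterZ L 1`, pure and dented member) DISCHARGED
# — the record twin of dag-n05-e g32's `B8Prop6DentedCubeMemberScalarGammaHolds`

statement-level skeleton of published theorems with citation tags; proofs where landed; nothing here is a claim about the Yang–Mills mass gap

`[Balaban1985RegularSpaces]` ("B8" = [6], CMP **99** (1985) 75–102) Prop. 6 (1.135)–(1.138) p. 99, p. 98, (1.59) p. 86, (1.62) p. 87; `[Balaban1985Variational]` ("[15]", CMP **102** (1985)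
277–309) (148)–(152) p. 301, p. 300; `[Balaban1985BackgroundPropagators]` ([4], CMP **99** (1985) 389–434) (3.14)–(3.15) p. 393, Thms 3.1–3.3 pp. 398–399; `[Balaban1987RG1]` ([I], CMP
**109** (1987) 249–301) (0.3)–(0.4) pp. 252–253.

CITATION HEADER (lean-in-tree rule).  Cell `pub-ymgap` (HUMAN RULING D-0062), «N05-REC» road, seat `pub-ymgap-dag-n05-cov` g0 (director-ym R509 (a): «if found ⇒ N05-REC crown … become
UNCONDITIONAL via `--supports 20541`»; bus INTENT-COV-1).  `--kind proof --supports stmt-QuantumFields-20541` (K0⁷; count-neutral).  WHY THIS FILE.  dag-n05-e g39 crowned the record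
road MODULO the two named facts of `B8Ineq159FlatCovPrintedRec` (`B8Prop6DentedCubeMemberScalarGammaOfNamedFactsRec.gaugedBoundB8DZ_dentedMember_of_cov159`, §3); this seat proved both
(`B8Ineq159FlatCovDentedCubeMemberRec.ineq159FlatCovPrintedZ_holds`, by bootstrap from the straight twins).  THIS FILE composes them by name: [6] Proposition 6's conclusion as NODE 00's
`GaugedBoundB8DZ` at EVERY dented centred member of print's sub-lattice, odd `L = 2s+1 ≥ 5`, `d ≥ 2`, unitary backgrounds, with NO named hypothesis left — the premise the R7 door consumes.

WHAT THIS FILE PROVES (kernel-checked; one composition by name).  ★★★ `gaugedBoundB8DZ_dentedMember_scalar_γ_holds (hd2 : 2 ≤ d) (hLs : L = 2sL+1) (hs2 : 2 ≤ sL)` — conclusion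
verbatim the crown's.
HONEST SCOPE ∕ NOT CLAIMED.  Composition by name of theorems of record; NO new estimate here; nothing of [4]∕[6]∕[15]∕[I] asserted beyond those theorems; count-neutral; the Summit-side
premise `HThm4Rec` is NOT discharged by this file (that is the R7 door's repackaging); N05 ∕ N07 NOT discharged; one finite `T⁴` programme at fixed `ε`, Bałaban as printed (plus the
bootstrap of `B8Ineq159FlatCov*Rec`, ours); nothing continuum ∕ ℝ⁴ ∕ OS ∕ mass-gap ∕ Clay.  No `sorry`, no `def`, no `instance`, no `notation`.
-/

noncomputable section

namespace Literature.MathematicalPhysics.QuantumFieldTheory.Balaban1983to89.B8Prop6DentedCubeMemberScalarGammaHoldsRec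

open scoped Matrix
open B7Prop1Explicit B7Prop2Explicit B7Prop1Local
open BlockAveragingZd (ctrShift)
open B8Ineq132 (InAk)
open B8Ineq159FlatCovDentedCubeMemberRec (ineq159FlatCovPrintedZ_holds)
open B8Prop6DentedCubeMemberScalarGammaOfNamedFactsRec (gaugedBoundB8DZ_dentedMember_of_cov159)
open Node00 (CubeB8DZ GaugedBoundB8DZ)
open Literature.MathematicalPhysics.QuantumLattice (blockMap)

export B7Prop1Explicit (Site)

variable {d : ℕ} {𝔸 : Type} [CStarAlgebra 𝔸] [Nontrivial 𝔸]

open Classical in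
/-- ★★★ **PROPOSITION 6 (p. 99) AS `Node00.GaugedBoundB8DZ` AT EVERY DENTED CENTRED CUBE MEMBER OF PRINT's BIG-BLOCK SUB-LATTICE, FOR ODD `L = 2s+1 ≥ 5` AND `d ≥ 2` —
UNCONDITIONALLY**: the record crown `gaugedBoundB8DZ_dentedMember_of_cov159` with its two named hypotheses ([4] Thm 3.3 ∕ [6] (1.59), (1.62) at `U₀ = 1` for the record's linearised
averaging `Q_j(1)`, on the pure and on the dented centred member) DISCHARGED by `B8Ineq159FlatCovDentedCubeMemberRec.ineq159FlatCovPrintedZ_holds` (`d = d′ + 1`, `L = ℓ + 1`,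
`ℓ = 2s ≥ 4`).  Conclusion verbatim the crown's: `∃ B₀ ≥ 1, c₁ > 0, ρ₀, M₀, N₀, R₀` such that for every `η > 0`, every dented record cube datum on print's p. 98 sub-lattice above
threshold with the anchored dent premise, every unitary `U₀ ∈ 𝔄_K({Ω_j}, α₀)` with `7dL²·c.M·α₀ ≤ c₁`: `GaugedBoundB8DZ L η U₀ c (7dL²·(5dLB₀)·c.M·α₀)`.
[cite: Balaban1985RegularSpaces, Prop. 6 (1.135)–(1.138) p.99, p.98, (1.59) p.86, (1.62) p.87; Balaban1985Variational, (148)–(152) p.301, p.300; Balaban1985BackgroundPropagators, (3.14)–(3.15) p.393, Thms 3.1–3.3 pp.398–399; Balaban1987RG1, (0.3)–(0.4) pp.252–253] -/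
theorem gaugedBoundB8DZ_dentedMember_scalar_γ_holds (hd2 : 2 ≤ d) {L sL : ℕ} (hLs : L = 2 * sL + 1) (hs2 : 2 ≤ sL) :
    ∃ B₀ c₁ ρ₀ M₀ : ℝ, ∃ N₀ R₀ : ℕ, 1 ≤ B₀ ∧ 0 < c₁ ∧ ∀ (η : ℝ), 0 < η → ∀ {K : ℕ} {Ω : ℕ → Set (Site d)} (c : CubeB8DZ d L K Ω),
      ∀ (s R : ℕ), 3 ≤ L ^ s → M₀ ≤ (L : ℝ) ^ (s + 1) → L ^ (s + 1) ∣ c.ρ → L ^ (s + 1) ∣ c.M → R * L ^ (s + 1) ≤ c.ρ → 2 * L ≤ R →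
        R₀ ≤ R → N₀ + 1 ≤ R * L ^ (s + 1) → ρ₀ ≤ (c.ρ : ℝ) →
      (∀ x y : Site d,
          blockMap (L ^ (s + 1) * L ^ c.k) (x - fun i => (L : ℤ) ^ c.k * (c.a i - c.ρ) - (ctrShift L c.k : ℤ)) =
            blockMap (L ^ (s + 1) * L ^ c.k) (y - fun i => (L : ℤ) ^ c.k * (c.a i - c.ρ) - (ctrShift L c.k : ℤ)) → x ∈ Ω c.k → y ∈ Ω c.k) →
      ∀ (U₀ : Site d → Fin d → 𝔸ˣ), (∀ x κ, U₀ x κ ∈ unitaryUnits 𝔸) → ∀ (α₀ : ℝ), 0 < α₀ → InAk L K η α₀ Ω U₀ →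
      7 * d * (L : ℝ) ^ 2 * c.M * α₀ ≤ c₁ →
      GaugedBoundB8DZ L η U₀ c (7 * d * (L : ℝ) ^ 2 * (5 * (d : ℝ) * L * B₀) * c.M * α₀) := by
  obtain ⟨d', rfl⟩ : ∃ d', d = d' + 1 := ⟨d - 1, by omega⟩
  obtain ⟨ℓ, rfl⟩ : ∃ ℓ, L = ℓ + 1 := ⟨2 * sL, by omega⟩
  have h := ineq159FlatCovPrintedZ_holds d' ℓ (by omega) ⟨sL, by omega⟩
  exact gaugedBoundB8DZ_dentedMember_of_cov159 (𝔸 := 𝔸) hd2 hLs hs2 h.1 h.2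

end Literature.MathematicalPhysics.QuantumFieldTheory.Balaban1983to89.B8Prop6DentedCubeMemberScalarGammaHoldsRec

end
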